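import Summits.QuantumFields.YangMills.Theorems.UnitScaleTiltProp7SectET3Objects
import Summits.QuantumFields.YangMills.Theorems.UnitScaleTiltProp7SPrintDefs
import Summits.QuantumFields.YangMills.Theorems.UnitScaleTiltProp7TPrintDefs
import HarnessLib

/-!
# Route `UnitScaleTilt`, crux K1 child «MinimiserStabilityRegPr» (stmt-QuantumFields-19200), skeleton v10 stub EX, route (α) `{C-min, COV}`, cut (S3)
# `C-min ⇐ P6@T³ ∧ (i) CHART ∧ (ii) GROWTH` (OWNER RULING g25-№1, DE-CONFLICT 01:54Z, 02:08:50Z) — DEFINITIONS FILE: **THE CHART ROW (i) AS A NAMED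
# PROPOSITION `Chart112T3`** — [Balaban1985Variational] (112) «U₁ = exp iη[A₁ + H₁B − HD(A₁ + H₁B)]» + Props 3, 5 + pp. 296–299 («the configuration
# A′₁ − HD(A′₁) = (1/iη) log U₁ satisfying all the conditions (19)–(21) with ε₂ = O(1)C₁B₃ε₁»), READ AT THE T³ OBJECTS OF RECORD (★w2-19200 g2's
# `Prop7SectET3Objects.prop6_bgOfCfg`, p596145: background `bgOfCfg F K U₀` on `Bond 3 (periodsT3 F K)`, levels `≡ K − n`, `η = L^{−(K−n)}`, letters `𝒢`,
# `W`, `H₁`, `B` universally quantified) WITH THE SECT. A–B LETTERS OF `S_print` (`AvgCondPrint`, `IsLandauPrint`, p582426) AND THE (19)-SIZE `nMax19` (p583497)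

Cell `ym3-torus` ∕ width seat `ym-ust-19200-w1` (gen 2).  YM₃ on T³ is ladder rung R3, not the Clay problem; nothing here is a claim about the crux or the gap.

WHY.  ★★OWNER 02:08:50Z: «your target is now PRECISELY ★w2 g2's CHART-112 sentence — (1) state it as a named Prop `Chart112T3 F n K … : Prop` with that text
VERBATIM (so file 3 binds it by name, not as an anonymous hypothesis); (2) split it by print: CHART-47-T³ = Prop. 3 one-step chart PORTED … [L] and
CHART-5-T³ = Prop. 5 k-step composition + (123)–(140) [displayed, XL]; (3) `chart112_of_prop3T3_prop5T3` proved».  THIS FILE is step (1): the sentence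
«∀ solution A₁ of (111)[𝒢, W, H₁B] in the (115)-ball: ∃ X Hermitian-traceless, `nMax19 F n K U₀ X ≤ M·(‖A₁‖ + ‖H₁B‖)`, `AvgCondPrint F n K h V U₀ X`,
`IsLandauPrint F n K U₀ X`» (★w2 g2 PROGRESS 1, 02:08:28Z; adopted by the owner 02:08:50Z), with the binders typed EXACTLY as `prop6_bgOfCfg` ∕ `prop6_T3_H₁B`
receive them, so that w2's `Cmin_of_P6T3_chart_growth` displays ONE named row and a later pin of the letters discharges it in one place.  Steps (2)–(3)
(`Chart47T3`, `Chart5T3`, the composition and the Prop-3 port) are the sibling proof file `…Prop7ChartT3`.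

THE PRINT.  [Balaban1985Variational] p. 294: «Proposition 5. All critical configurations U₁ of the functional A(U₁U₀) in the space defined by (19)–(21), U₀
satisfies (14), can be obtained from solutions of Eq. (111) in the space (104) by the transformation U₁ = exp iη[A₁ + H₁B − HD(A₁ + H₁B)]. (112)»; p. 289:
«Proposition 3. The transformation (47) satisfying the identity (48), i.e. linearizing the averaging operation Q(ηA), is defined and analytic for A′
satisfying (43) with ε₃ sufficiently small … The range of this transformation contains the set (43) with ε₂ ≦ ¼ε₃, and is contained in the corresponding set
with 2ε₃ instead of ε₂»; p. 299: «Thus the transformation (47) applied to A′₁ yields the configuration A′₁ − HD(A′₁) = (1/iη) log U₁ satisfying all the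
conditions (19)–(21) with ε₂ = O(1)C₁B₃ε₁, where O(1) is an absolute constant depending on d and L only. Now we take the configuration U₁U₀ and we apply
to it a gauge transformation u satisfying the conditions R̄₀u = 1 on Λ_j and such that the gauge transformed configuration (U₁U₀)ᵘ satisfies the axial gauge
conditions Ax_k(𝔅_k, U₀) … Proposition 7 [6] implies that U_k belongs to the space (18)».

DECLARED READING ∕ HONEST SCOPE.  (i) A HYPOTHESIS SHAPE (a `Prop` with a body), asserted for nothing: no theorem of this file claims `Chart112T3`.  (ii) The
letters `𝒢` ((117), [5] Thm 3.13), `W` (Prop. 4), `H₁` ([5] Thm 3.12 as used in (103)) and the constraint configuration `B` of (20) are the SAME universally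
quantified letters as in `Prop7SectET3Objects.prop6_bgOfCfg` ∕ `B11Prop6Concrete.exists_solution_concrete_H₁B` — NOT pinned to the operators (45), (110) or to
(1.31)'s `B = (1/i) log(V(Ū₀ᵏ)⁻¹)`; the printed sentence holds at the pinned operators, so AS A HYPOTHESIS over abstract letters this row is a LAW-type display
(true of the intended instance), recorded as such (this seat's LOCATE, HOME STATUS 2026-08-28 ≈03:0xZ).  (iii) (20) is read in `S_print`'s Σ_k FORM `AvgCondPrint`
([Balaban1985RegularSpaces] (1.28)–(1.30)); print reaches it from the equation form (48)∕(1.31) by the p. 299 sentence quoted above + [6] Prop. 7 — that bridge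
is part of the row's content (CHART-5-T³), not of this file.  (iv) `M·(‖A₁‖ + ‖H₁B‖)` is print's «ε₂ = O(1)C₁B₃ε₁» read through (103) `|H₁B| < B₀2dLC₁ε₁` and
Prop. 6 `‖A₁‖ < 3B₀C₁B₃ε₁`.  Count-neutral toward stmt-QuantumFields-19200 (`--supports`); definitions + `Iff.rfl` unfoldings only; nothing continuum ∕ OS ∕
mass-gap ∕ Clay.

References: T. Bałaban, CMP **102** (1985) 277–309 [Balaban1985Variational] ((19)–(21) p.281, (43) p.285, (45)–(48) p.285, Prop. 3 p.289, (101)–(104) p.293,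
(111)–(112) p.294, (115) p.294, Prop. 6 p.295, (123)–(140) pp.296–299, Prop. 7 p.299); CMP **99** (1985) 75–102 [Balaban1985RegularSpaces] ((1.19) p.79,
(1.28)–(1.31) pp.81–82, (1.38) p.82, Prop. 7 (1.144) p.100); CMP **99** (1985) 389–434 [Balaban1985BackgroundPropagators] (Thms 3.12–3.13 pp.420–423).
-/

noncomputable section

open scoped Matrix.Norms.L2Operator

namespace Summit.QuantumFields.YangMills.Theorems.Prop7ChartT3

open Literature.MathematicalPhysics.QuantumFieldTheory.Balaban1983to89
open T3ContinuumYM3Torus T3PrintedRegularMinimiser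
open B9SectCLatticeCarrier (Bond)
open B11Eq115Space (NegSize Space115)
open B11Eq111FrakG (nabla115)
open B11Eq98CurrentSlot (Jcur)
open Summit.QuantumFields.YangMills.Theorems.Prop7SectET3Transport (periodsT3 bgOfCfg)
open Summit.QuantumFields.YangMills.Theorems.Prop7SPrint (AvgCondPrint IsLandauPrint)
open Summit.QuantumFields.YangMills.Theorems.Prop7TPrint (nMax19)

/-! ## §1 The chart row (i) of the (S3) cut, as a named proposition -/

/-- **CHART-112 AT THE T³ OBJECTS OF RECORD — the row (i) of `C-min ⇐ P6@T³ ∧ CHART ∧ GROWTH` as a NAMED HYPOTHESIS SHAPE** (member `F`, heights `n ≤ K`,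
`k = K − n`, `η = L^{−k}`; background `bgOfCfg F K U₀` on `Bond 3 (periodsT3 F K)`; the (115)-space `Space115 L η (lev ≡ k) (lev ≡ k) (nabla115 η (bgOfCfg F K U₀))`;
letters `𝒢 = 𝔊(U₀)`, `W = (δ/δA′)V`, `H₁ = H₁(U₀)` on block data `β → M₂(ℂ)`, constraint configuration `B`; radius `ε₄` of the (115)-ball, constant `M`):
«for EVERY solution `A₁` of Eq. (111) `A₁ + 𝒢J(U₀) + 𝒢(W(A₁ + H₁B)) = 0` in the (115)-ball of radius `ε₄` there is an exponent `X : bonds of T_η → M₂(ℂ)`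
(print's `ηA`, `A = A′ − HD(A′)`, `A′ = A₁ + H₁B`, (112) ∘ (47) ∘ (101)), bondwise Hermitian and traceless (`𝔰𝔲(2)`), of (19)-size
`nMax19 F n K U₀ X ≤ M·(‖A₁‖₍₁₁₅₎ + ‖H₁B‖₍₁₁₅₎)` («satisfying all the conditions (19)–(21) with ε₂ = O(1)C₁B₃ε₁», p. 299, through (57)–(58), (103), (136)–(140)),
satisfying (20) in the Σ_k form `AvgCondPrint F n K h V U₀ X` ((48) «Q_j(η(A′ − HD(A′))) = LʲηQ_jA′» + (102) + the p. 299 gauge transformation `u` with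
`R̄₀u = 1` + [6] Prop. 7) and (21) `IsLandauPrint F n K U₀ X` ((76) «RD*(A′ − HD(A′)) = RD*A′ = 0» by (45) `RD*H = 0` and (102))».
ASSERTED FOR NOTHING; the letters are NOT pinned here (see the module docstring (ii)).
[cite: Balaban1985Variational, (112) p.294, Prop. 5 p.294, Prop. 3 p.289, (47)–(48) p.285, (101)–(104) p.293, (111) p.294, p.299; Balaban1985RegularSpaces, (1.28)–(1.31) pp.81–82, Prop. 7 (1.144) p.100] -/
def Chart112T3 (F : T3Family) (n K : ℕ) (h : n ≤ K) [Fact (0 < (F.L : ℝ))] [Fact (0 < ((F.L : ℝ)⁻¹) ^ (K - n))] (ε₄ M : ℝ)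
    (V : GaugeField (F.P n) 0 (Matrix.specialUnitaryGroup (Fin 2) ℂ)) (U₀ : GaugeField (F.P K) 0 (Matrix.specialUnitaryGroup (Fin 2) ℂ))
    (𝒢 : NegSize (F.L : ℝ) (((F.L : ℝ)⁻¹) ^ (K - n)) (fun _ : Bond 3 (periodsT3 F K) => K - n) 3 (Matrix (Fin 2) (Fin 2) ℂ) →L[ℂ]
          Space115 (F.L : ℝ) (((F.L : ℝ)⁻¹) ^ (K - n)) (fun _ : Bond 3 (periodsT3 F K) => K - n) (fun _ : Bond 3 (periodsT3 F K) × Fin 3 => K - n)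
            (nabla115 (((F.L : ℝ)⁻¹) ^ (K - n)) (bgOfCfg F K U₀)))
    (W : Space115 (F.L : ℝ) (((F.L : ℝ)⁻¹) ^ (K - n)) (fun _ : Bond 3 (periodsT3 F K) => K - n) (fun _ : Bond 3 (periodsT3 F K) × Fin 3 => K - n)
            (nabla115 (((F.L : ℝ)⁻¹) ^ (K - n)) (bgOfCfg F K U₀)) →
          NegSize (F.L : ℝ) (((F.L : ℝ)⁻¹) ^ (K - n)) (fun _ : Bond 3 (periodsT3 F K) => K - n) 3 (Matrix (Fin 2) (Fin 2) ℂ))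
    {β : Type} [Fintype β]
    (H₁ : (β → Matrix (Fin 2) (Fin 2) ℂ) →L[ℂ]
          Space115 (F.L : ℝ) (((F.L : ℝ)⁻¹) ^ (K - n)) (fun _ : Bond 3 (periodsT3 F K) => K - n) (fun _ : Bond 3 (periodsT3 F K) × Fin 3 => K - n)
            (nabla115 (((F.L : ℝ)⁻¹) ^ (K - n)) (bgOfCfg F K U₀)))
    (B : β → Matrix (Fin 2) (Fin 2) ℂ) : Prop :=
  ∀ A₁ : Space115 (F.L : ℝ) (((F.L : ℝ)⁻¹) ^ (K - n)) (fun _ : Bond 3 (periodsT3 F K) => K - n) (fun _ : Bond 3 (periodsT3 F K) × Fin 3 => K - n)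
            (nabla115 (((F.L : ℝ)⁻¹) ^ (K - n)) (bgOfCfg F K U₀)),
    ‖A₁‖ < ε₄ → A₁ + 𝒢 (Jcur (bgOfCfg F K U₀)) + 𝒢 (W (A₁ + H₁ B)) = 0 →
      ∃ X : PBond (F.P K) 0 → Matrix (Fin 2) (Fin 2) ℂ,
        (∀ b : PBond (F.P K) 0, (X b).IsHermitian ∧ Matrix.trace (X b) = 0) ∧
        nMax19 F n K U₀ X ≤ M * (‖A₁‖ + ‖H₁ B‖) ∧ AvgCondPrint F n K h V U₀ X ∧ IsLandauPrint F n K U₀ X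

/-! ## §2 Unfoldings (definitional) -/

section Unfold

variable (F : T3Family) (n K : ℕ) (h : n ≤ K) [Fact (0 < (F.L : ℝ))] [Fact (0 < ((F.L : ℝ)⁻¹) ^ (K - n))] (ε₄ M : ℝ)
    (V : GaugeField (F.P n) 0 (Matrix.specialUnitaryGroup (Fin 2) ℂ)) (U₀ : GaugeField (F.P K) 0 (Matrix.specialUnitaryGroup (Fin 2) ℂ))
    (𝒢 : NegSize (F.L : ℝ) (((F.L : ℝ)⁻¹) ^ (K - n)) (fun _ : Bond 3 (periodsT3 F K) => K - n) 3 (Matrix (Fin 2) (Fin 2) ℂ) →L[ℂ]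
          Space115 (F.L : ℝ) (((F.L : ℝ)⁻¹) ^ (K - n)) (fun _ : Bond 3 (periodsT3 F K) => K - n) (fun _ : Bond 3 (periodsT3 F K) × Fin 3 => K - n)
            (nabla115 (((F.L : ℝ)⁻¹) ^ (K - n)) (bgOfCfg F K U₀)))
    (W : Space115 (F.L : ℝ) (((F.L : ℝ)⁻¹) ^ (K - n)) (fun _ : Bond 3 (periodsT3 F K) => K - n) (fun _ : Bond 3 (periodsT3 F K) × Fin 3 => K - n)
            (nabla115 (((F.L : ℝ)⁻¹) ^ (K - n)) (bgOfCfg F K U₀)) →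
          NegSize (F.L : ℝ) (((F.L : ℝ)⁻¹) ^ (K - n)) (fun _ : Bond 3 (periodsT3 F K) => K - n) 3 (Matrix (Fin 2) (Fin 2) ℂ))
    {β : Type} [Fintype β]
    (H₁ : (β → Matrix (Fin 2) (Fin 2) ℂ) →L[ℂ]
          Space115 (F.L : ℝ) (((F.L : ℝ)⁻¹) ^ (K - n)) (fun _ : Bond 3 (periodsT3 F K) => K - n) (fun _ : Bond 3 (periodsT3 F K) × Fin 3 => K - n)
            (nabla115 (((F.L : ℝ)⁻¹) ^ (K - n)) (bgOfCfg F K U₀)))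
    (B : β → Matrix (Fin 2) (Fin 2) ℂ)

/-- `Chart112T3` UNFOLDED (definitional; consumers bind an inline-displayed copy of the sentence by `Iff.rfl`). [cite: Balaban1985Variational, (112) p.294] -/
theorem chart112T3_iff :
    Chart112T3 F n K h ε₄ M V U₀ 𝒢 W H₁ B ↔
      ∀ A₁ : Space115 (F.L : ℝ) (((F.L : ℝ)⁻¹) ^ (K - n)) (fun _ : Bond 3 (periodsT3 F K) => K - n) (fun _ : Bond 3 (periodsT3 F K) × Fin 3 => K - n)
            (nabla115 (((F.L : ℝ)⁻¹) ^ (K - n)) (bgOfCfg F K U₀)),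
        ‖A₁‖ < ε₄ → A₁ + 𝒢 (Jcur (bgOfCfg F K U₀)) + 𝒢 (W (A₁ + H₁ B)) = 0 →
          ∃ X : PBond (F.P K) 0 → Matrix (Fin 2) (Fin 2) ℂ,
            (∀ b : PBond (F.P K) 0, (X b).IsHermitian ∧ Matrix.trace (X b) = 0) ∧
            nMax19 F n K U₀ X ≤ M * (‖A₁‖ + ‖H₁ B‖) ∧ AvgCondPrint F n K h V U₀ X ∧ IsLandauPrint F n K U₀ X :=
  Iff.rfl

variable {F n K h ε₄ M V U₀ 𝒢 W H₁ B}

/-- **READING THE ROW AT A SOLUTION** (the use in `Cmin_of_P6T3_chart_growth`): `Chart112T3` and a solution `A₁` of (111) in the (115)-ball give the exponent `X`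
with its four clauses. [cite: Balaban1985Variational, (112) p.294, Prop. 6 p.295] -/
theorem Chart112T3.exists_exponent (hC : Chart112T3 F n K h ε₄ M V U₀ 𝒢 W H₁ B)
    {A₁ : Space115 (F.L : ℝ) (((F.L : ℝ)⁻¹) ^ (K - n)) (fun _ : Bond 3 (periodsT3 F K) => K - n) (fun _ : Bond 3 (periodsT3 F K) × Fin 3 => K - n)
            (nabla115 (((F.L : ℝ)⁻¹) ^ (K - n)) (bgOfCfg F K U₀))}
    (hA₁ : ‖A₁‖ < ε₄) (h111 : A₁ + 𝒢 (Jcur (bgOfCfg F K U₀)) + 𝒢 (W (A₁ + H₁ B)) = 0) :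
    ∃ X : PBond (F.P K) 0 → Matrix (Fin 2) (Fin 2) ℂ,
      (∀ b : PBond (F.P K) 0, (X b).IsHermitian ∧ Matrix.trace (X b) = 0) ∧
      nMax19 F n K U₀ X ≤ M * (‖A₁‖ + ‖H₁ B‖) ∧ AvgCondPrint F n K h V U₀ X ∧ IsLandauPrint F n K U₀ X :=
  hC A₁ hA₁ h111

/-- **MONOTONICITY IN THE CONSTANT**: a larger `M′ ≥ M` (with `M ≥ 0` not needed: the bound only grows) weakens the row.
[cite: Balaban1985Variational, p.299 («ε₂ = O(1)C₁B₃ε₁»)] -/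
theorem Chart112T3.mono {M' : ℝ} (hC : Chart112T3 F n K h ε₄ M V U₀ 𝒢 W H₁ B) (hM : M ≤ M') :
    Chart112T3 F n K h ε₄ M' V U₀ 𝒢 W H₁ B := by
  intro A₁ hA₁ h111
  obtain ⟨X, hX, hsize, h20, h21⟩ := hC A₁ hA₁ h111
  exact ⟨X, hX, hsize.trans (mul_le_mul_of_nonneg_right hM (by positivity)), h20, h21⟩

/-- **MONOTONICITY IN THE RADIUS**: a smaller (115)-ball `ε₄′ ≤ ε₄` weakens the row. [cite: Balaban1985Variational, (115) p.294] -/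
theorem Chart112T3.anti {ε₄' : ℝ} (hC : Chart112T3 F n K h ε₄ M V U₀ 𝒢 W H₁ B) (hε : ε₄' ≤ ε₄) :
    Chart112T3 F n K h ε₄' M V U₀ 𝒢 W H₁ B :=
  fun A₁ hA₁ h111 => hC A₁ (lt_of_lt_of_le hA₁ hε) h111

end Unfold

end Summit.QuantumFields.YangMills.Theorems.Prop7ChartT3

end
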